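import Summits.CriticalPhenomena.CardyFormulaZ2.Theorems.CardyMagicRigidityNestingRigidityNeckVirtualEdges
import Summits.CriticalPhenomena.CardyFormulaZ2.Theorems.CardyMagicRigidityNestingRigidityTomographyDictionary
import HarnessLib

/-!
# The covering lemma for `𝔄 = THookStar ∖ THook` (stub S11, road map item 1): minimal families of virtual edges

Generic reachability bookkeeping, the geometry of cells and virtual edges, crossing extraction (`exists_crossing_of_pathIn`),
augmented chains (`augSteps`), and `covering_A`: for a minimal re-connecting family of virtual edges, every sub-family /
centre / scale node carries the honest cluster-form four-arm event (two open crossings of a hexagonal annulus `tAnn w r R` in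
distinct open clusters of the annulus).
-/

noncomputable section

namespace Summit.CriticalPhenomena.CardyFormulaZ2.Cruxes.NestingRigidity.PinchResampling

open MeasureTheory Set Literature.Probability.Percolation Literature.Probability.LatticeModels
open scoped symmDiff

/-! ### Road map item 1 for `𝔄`, general node form: the covering lemma (minimal family of virtual edges) -/

section Covering

/-! #### Generic reachability bookkeeping -/

/-- Along a chain from a point of `P` to a point outside `P` there is a step leaving `P`, preceded by a chain inside... from
the start. -/
theorem reflTransGen_exists_step_out {α : Type*} {r : α → α → Prop} {P : Set α} {a b : α}
    (h : Relation.ReflTransGen r a b) (ha : a ∈ P) (hb : b ∉ P) :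
    ∃ y z, y ∈ P ∧ z ∉ P ∧ r y z ∧ Relation.ReflTransGen r a y := by
  induction h with
  | refl => exact (hb ha).elim
  | @tail y z hay hyz ih =>
    by_cases hy : y ∈ P
    · exact ⟨y, z, hy, hb, hyz, hay⟩
    · obtain ⟨y', z', hy', hz', hr, hc⟩ := ih hy
      exact ⟨y', z', hy', hz', hr, hc⟩

variable {ℓ lam s : ℕ} {x o : Site 2} {η : SiteConfig (Site 2)}

/-! #### Geometry: steps of `𝕋` move `triNorm` by one; cells have diameter `< 2ℓ`; virtual edges are short -/

/-- Two points in the same `ℓ`-cell are at `triNorm`-distance `≤ 2ℓ`. -/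
theorem triNorm_sub_le_of_cellOf_eq (hℓ : 1 ≤ ℓ) {v v' : Site 2} (h : cellOf ℓ o v = cellOf ℓ o v') :
    triNorm (v - v') ≤ 2 * ℓ := by
  have hℓ' : (0 : ℤ) < ℓ := by exact_mod_cast hℓ
  have hc : ∀ i, (v i - o i) / (ℓ : ℤ) = (v' i - o i) / (ℓ : ℤ) := fun i ↦ congrFun h i
  have key : ∀ i, |v i - v' i| < ℓ := by
    intro i
    obtain ⟨e1, m1, l1⟩ := (Int.ediv_emod_unique hℓ').1 ⟨rfl, (rfl : (v i - o i) % (ℓ : ℤ) = _)⟩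
    obtain ⟨e2, m2, l2⟩ := (Int.ediv_emod_unique hℓ').1 ⟨rfl, (rfl : (v' i - o i) % (ℓ : ℤ) = _)⟩
    rw [abs_lt]
    have := hc i
    rw [this] at e1
    constructor <;> nlinarith
  rw [triNorm_le_iff]
  have k0 := key 0
  have k1 := key 1
  simp only [Pi.sub_apply, abs_lt, abs_le] at k0 k1 ⊢
  omega

/-- The two endpoints of a virtual edge are at `triNorm`-distance `≤ 2ℓ + 1`. -/
theorem triNorm_sub_le_of_mem_vEdges (hℓ : 1 ≤ ℓ) {a c : Site 2} (h : (a, c) ∈ vEdges ℓ lam s x o η) :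
    triNorm (a - c) ≤ 2 * ℓ + 1 := by
  obtain ⟨-, -, -, -, -, w', -, hadj, hcell⟩ := h
  change triGraph.Adj a w' at hadj
  change cellOf ℓ o w' = cellOf ℓ o c at hcell
  have h1 : triNorm (a - c) ≤ triNorm (w' - c) + 1 := triNorm_sub_le_of_adj hadj.symm c
  have h2 := triNorm_sub_le_of_cellOf_eq hℓ hcell
  omega

/-! #### Crossing extraction -/

-- adapted from `Literature.Probability.Percolation.PathIn.last_exit_or` (SitePaths), with the prefix kept
/-- **Last visit, with prefix**: a path inside `A` from a vertex of `C` to a vertex outside `C` contains an edge `a ∼ b`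
with `a ∈ C`, `b ∉ C`, preceded by a path inside `A` from the start to `a` and followed by a path inside `A ∖ C` from `b`
to the end. -/
theorem pathIn_last_exit_prefix_or {V : Type*} {G : SimpleGraph V} {A C : Set V} {u v : V} (h : PathIn G A u v)
    (hu : u ∈ C) : v ∈ C ∨ ∃ a b, a ∈ C ∧ PathIn G A u a ∧ b ∉ C ∧ G.Adj a b ∧ PathIn G (A \ C) b v := by
  obtain ⟨huA, p⟩ := h
  induction p with
  | refl => exact Or.inl hu
  | @tail b c hub hbc ih =>
    by_cases hc : c ∈ C
    · exact Or.inl hc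
    · right
      by_cases hb : b ∈ C
      · exact ⟨b, c, hb, ⟨huA, hub⟩, hc, hbc.1, PathIn.refl ⟨hbc.2, hc⟩⟩
      · rcases ih with ih | ⟨a, b', ha, hpa, hb', hab', hp⟩
        · exact absurd ih hb
        · exact ⟨a, b', ha, hpa, hb', hab', hp.tail hbc.1 ⟨hbc.2, hc⟩⟩

/-- **Last visit, with prefix** (the exit form). -/
theorem pathIn_last_exit_prefix {V : Type*} {G : SimpleGraph V} {A C : Set V} {u v : V} (h : PathIn G A u v)
    (hu : u ∈ C) (hv : v ∉ C) :
    ∃ a b, a ∈ C ∧ PathIn G A u a ∧ b ∉ C ∧ G.Adj a b ∧ PathIn G (A \ C) b v := by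
  rcases pathIn_last_exit_prefix_or h hu with h' | h'
  · exact absurd h' hv
  · exact h'

/-- The hexagonal annulus `{r ≤ |y - w|_𝕋 ≤ R}` around `w`. -/
def tAnn (w : Site 2) (r R : ℕ) : Set (Site 2) := {y | (r : ℤ) ≤ triNorm (y - w) ∧ triNorm (y - w) ≤ R}

/-- **Crossing extraction**: an open path (inside any region `S`) from inside `Λ_{r-1}(w)` to outside `Λ_{R-1}(w)` contains a
crossing of the annulus `{r ≤ |· - w| ≤ R}`, inside `S`, whose start is joined to the start of the path inside `S`. -/
theorem exists_crossing_of_pathIn {S : Set (Site 2)} {w y q : Site 2} {r R : ℕ} (hrR : r ≤ R)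
    (hy : triNorm (y - w) < r) (hq : (R : ℤ) ≤ triNorm (q - w)) (hp : PathIn (tColourGraph η true) S y q) :
    ∃ p₁ q₁, triNorm (p₁ - w) = r ∧ triNorm (q₁ - w) = R ∧
      PathIn (tColourGraph η true) (S ∩ tAnn w r R) p₁ q₁ ∧ PathIn (tColourGraph η true) S y p₁ := by
  set H := tColourGraph η true with hH
  have hHG : ∀ {a b : Site 2}, H.Adj a b → triGraph.Adj a b := fun hab ↦ by
    rw [hH, tColourGraph_true, siteOpenGraph_adj] at hab; exact hab.1
  -- cut at the first exit from `{|· - w| < R}`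
  obtain ⟨a, bb, haR, hbbR, hbbS, hadj, hpref⟩ :=
    hp.exit (R := {z | triNorm (z - w) < R}) (show triNorm (y - w) < R by omega) (show ¬ triNorm (q - w) < R by omega)
  simp only [mem_setOf_eq, not_lt] at haR hbbR
  have hbbR' : triNorm (bb - w) = R := le_antisymm (by have := triNorm_sub_le_of_adj (hHG hadj) w; omega) hbbR
  -- the path `y → a → bb` inside `T := {|· - w| ≤ R} ∩ S`
  have hsub : {z | triNorm (z - w) < R} ∩ S ⊆ {z | triNorm (z - w) ≤ R} ∩ S :=
    fun z hz ↦ ⟨le_of_lt (show triNorm (z - w) < R from hz.1), hz.2⟩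
  have hpT : PathIn H ({z | triNorm (z - w) ≤ R} ∩ S) y bb := (hpref.mono hsub).tail hadj ⟨hbbR'.le, hbbS⟩
  -- last exit from `C := {|· - w| ≤ r - 1}`, keeping the prefix
  obtain ⟨a', p₁, ha'C, hya', hp₁C, hadj', hsuf⟩ :=
    pathIn_last_exit_prefix (C := {z | triNorm (z - w) ≤ (r : ℤ) - 1}) hpT (show triNorm (y - w) ≤ (r : ℤ) - 1 by omega)
      (show ¬ triNorm (bb - w) ≤ (r : ℤ) - 1 by omega)
  simp only [mem_setOf_eq, not_le] at ha'C hp₁C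
  have hp₁r : triNorm (p₁ - w) = r :=
    le_antisymm (by have := triNorm_sub_le_of_adj (hHG hadj') w; omega) (by omega)
  refine ⟨p₁, bb, hp₁r, hbbR', hsuf.mono ?_, (hya'.mono inter_subset_right).tail hadj' (hsuf.left_mem).1.2⟩
  rintro z ⟨⟨hzR, hzS⟩, hzC⟩
  simp only [mem_setOf_eq, not_le] at hzC
  exact ⟨hzS, by omega, hzR⟩

/-! #### Augmented chains: real open edges plus a set of virtual edges -/

/-- Steps of `Λ_{2s}(x)` augmented by a set `F` of virtual edges (in either orientation). -/
def augSteps (s : ℕ) (x : Site 2) (η : SiteConfig (Site 2)) (F : Set (Site 2 × Site 2)) : Set (Site 2 × Site 2) :=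
  {q | ((tColourGraph η true).Adj q.1 q.2 ∧ q.1 ∈ tBall x (2 * s) ∧ q.2 ∈ tBall x (2 * s)) ∨ q ∈ F ∨ (q.2, q.1) ∈ F}

/-- The step relation of the refinement lemma is the augmentation by ALL virtual edges. -/
theorem steps_eq_augSteps : steps ℓ lam s x o η = augSteps s x η (vEdges ℓ lam s x o η) := rfl

/-- Augmented steps are symmetric. -/
theorem augSteps_symm {F : Set (Site 2 × Site 2)} {a b : Site 2} (h : (a, b) ∈ augSteps s x η F) :
    (b, a) ∈ augSteps s x η F := by
  rcases h with ⟨hadj, ha, hb⟩ | hF | hF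
  · exact Or.inl ⟨hadj.symm, hb, ha⟩
  · exact Or.inr (Or.inr hF)
  · exact Or.inr (Or.inl hF)

/-- Augmented chains are monotone in the set of virtual edges. -/
theorem augChain_mono {F G : Set (Site 2 × Site 2)} (hFG : F ⊆ G) {a b : Site 2}
    (h : Relation.ReflTransGen (fun a b ↦ (a, b) ∈ augSteps s x η F) a b) :
    Relation.ReflTransGen (fun a b ↦ (a, b) ∈ augSteps s x η G) a b := by
  induction h with
  | refl => exact Relation.ReflTransGen.refl
  | tail _ hab ih =>
    refine ih.tail ?_
    rcases hab with h1 | h2 | h3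
    · exact Or.inl h1
    · exact Or.inr (Or.inl (hFG h2))
    · exact Or.inr (Or.inr (hFG h3))

/-- A real open path of `Λ_{2s}(x)` is an augmented chain (for any `F`). -/
theorem augChain_of_pathIn (F : Set (Site 2 × Site 2)) {a b : Site 2}
    (hp : PathIn (tColourGraph η true) (tBall x (2 * s)) a b) :
    Relation.ReflTransGen (fun a b ↦ (a, b) ∈ augSteps s x η F) a b := by
  obtain ⟨ha, p⟩ := hp
  induction p with
  | refl => exact Relation.ReflTransGen.refl
  | @tail y z hay hyz ih =>
    have hy : y ∈ tBall x (2 * s) := PathIn.right_mem (show PathIn (tColourGraph η true) _ a y from ⟨ha, hay⟩)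
    exact ih.tail (Or.inl ⟨hyz.1, hy, hyz.2⟩)

/-- **Real classes along an augmented chain**: a point reached from `b` by an augmented chain over `G` is joined by a real
open path of `Λ_{2s}(x)` either to `b` or to an endpoint of a virtual edge of `G`. -/
theorem real_or_endpoint_of_augChain {G : Set (Site 2 × Site 2)}
    (hG : ∀ e ∈ G, e.1 ∈ tBall x (2 * s) ∧ e.2 ∈ tBall x (2 * s)) {b z : Site 2} (hb : b ∈ tBall x (2 * s))
    (h : Relation.ReflTransGen (fun a b ↦ (a, b) ∈ augSteps s x η G) b z) :
    PathIn (tColourGraph η true) (tBall x (2 * s)) b z ∨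
      ∃ e ∈ G, PathIn (tColourGraph η true) (tBall x (2 * s)) e.1 z ∨ PathIn (tColourGraph η true) (tBall x (2 * s)) e.2 z := by
  induction h with
  | refl => exact Or.inl (PathIn.refl hb)
  | @tail y z _ hyz ih =>
    rcases hyz with ⟨hadj, -, hzO⟩ | hF | hF
    · rcases ih with h1 | ⟨e, he, h2 | h2⟩
      · exact Or.inl (h1.tail hadj hzO)
      · exact Or.inr ⟨e, he, Or.inl (h2.tail hadj hzO)⟩
      · exact Or.inr ⟨e, he, Or.inr (h2.tail hadj hzO)⟩
    · exact Or.inr ⟨(y, z), hF, Or.inr (PathIn.refl (hG _ hF).2)⟩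
    · exact Or.inr ⟨(z, y), hF, Or.inl (PathIn.refl (hG _ hF).1)⟩

/-! #### The covering lemma for `𝔄` -/

/-- The annulus of outer radius `R ≤ s - 1` around an inner-layer site lies inside the big ball. -/
theorem tAnn_subset_tBall {w : Site 2} (hw : w ∈ innerLayer triGraph (tBall x s) (tBall x (2 * s))) {r R : ℕ}
    (hR : R + 1 ≤ s) : tAnn w r R ⊆ tBall x (2 * s) := by
  intro z hz
  have h1 := triNorm_le_of_mem_innerLayer hw
  have h2 := triNorm_sub_le_triNorm_sub_add z w x
  simp only [tBall, mem_setOf_eq]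
  have := hz.2
  push_cast
  omega

/-- Virtual edges have both endpoints in the big ball. -/
theorem mem_tBall_of_mem_vEdges {e : Site 2 × Site 2} (he : e ∈ vEdges ℓ lam s x o η) :
    e.1 ∈ tBall x (2 * s) ∧ e.2 ∈ tBall x (2 * s) := by
  obtain ⟨-, h1, -, h2, -⟩ := he
  refine ⟨?_, h2.1.1⟩
  simp only [tBall, mem_setOf_eq] at h1 ⊢
  push_cast; omega

/-- **Covering lemma for `𝔄` (road map, item 1; deterministic, general node form).**  On `THookStar ∖ THook` (`1 ≤ ℓ`,
`1 ≤ lam`, `lam + 1 ≤ s`) there is a nonempty finite family `F` of virtual edges — a MINIMAL one re-connecting the two open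
crossing clusters — such that for EVERY nonempty sub-family `𝒩 ⊆ F` and every inner-layer centre `w` with the locales
(collar endpoints) of `𝒩` inside `Λ_Δ(w)` and those of `F ∖ 𝒩` outside `Λ_{Γ-1}(w)`, every annulus
`{r ≤ |· - w|_𝕋 ≤ R}` with `Δ + 2ℓ + 2 ≤ r ≤ R`, `R + 2ℓ + 2 ≤ Γ`, `R + 2 ≤ s` is crossed by two open paths lying in distinct
open clusters OF THE ANNULUS (cluster form of four alternating arms around `w` from radius `r` to radius `R`; for `𝒩 = F` the
separation hypothesis is void and `R` goes up to `s - 2`). -/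
theorem covering_A (hℓ : 1 ≤ ℓ) (hlam : 1 ≤ lam) (hls : lam + 1 ≤ s) (hS : η ∈ THookStar ℓ lam s x o)
    (hnH : η ∉ THook x x s s) :
    ∃ F : Finset (Site 2 × Site 2), ↑F ⊆ vEdges ℓ lam s x o η ∧ F.Nonempty ∧
      ∀ 𝒩 ⊆ F, 𝒩.Nonempty → ∀ (w : Site 2) (Δ r R Γ : ℕ),
        w ∈ innerLayer triGraph (tBall x s) (tBall x (2 * s)) →
        (∀ e ∈ 𝒩, triNorm (e.2 - w) ≤ Δ) → (∀ e ∈ F, e ∉ 𝒩 → (Γ : ℤ) ≤ triNorm (e.2 - w)) →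
        Δ + 2 * ℓ + 2 ≤ r → r ≤ R → R + 2 * ℓ + 2 ≤ Γ → R + 2 ≤ s →
        ∃ p₁ q₁ p₂ q₂, triNorm (p₁ - w) = r ∧ triNorm (q₁ - w) = R ∧ triNorm (p₂ - w) = r ∧ triNorm (q₂ - w) = R ∧
          PathIn (tColourGraph η true) (tAnn w r R) p₁ q₁ ∧ PathIn (tColourGraph η true) (tAnn w r R) p₂ q₂ ∧
          ¬ PathIn (tColourGraph η true) (tAnn w r R) p₁ p₂ := by
  classical
  set K := tBall x s with hK
  set O := tBall x (2 * s) with hO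
  set H := tColourGraph η true with hH
  obtain ⟨b, b', hb, hb', hnR, hchain⟩ := exists_stepChain_of_tHookStar hlam hls hS hnH
  rw [steps_eq_augSteps] at hchain
  -- the finite universe of virtual edges and a minimal re-connecting family
  have hfin : (vEdges ℓ lam s x o η).Finite :=
    ((tBall_finite x (2 * s)).prod (tBall_finite x (2 * s))).subset fun e he ↦
      ⟨(mem_tBall_of_mem_vEdges he).1, (mem_tBall_of_mem_vEdges he).2⟩
  set U : Finset (Site 2 × Site 2) := hfin.toFinset with hU
  let chain : Finset (Site 2 × Site 2) → Prop := fun F ↦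
    Relation.ReflTransGen (fun a c ↦ (a, c) ∈ augSteps s x η ↑F) b b'
  set 𝒞 := U.powerset.filter chain with h𝒞
  have hU𝒞 : U ∈ 𝒞 := by
    refine Finset.mem_filter.2 ⟨Finset.mem_powerset.2 subset_rfl, ?_⟩
    simpa [chain, hU] using hchain
  obtain ⟨F, hF𝒞, hFmin⟩ := Finset.exists_min_image 𝒞 Finset.card ⟨U, hU𝒞⟩
  obtain ⟨hFU, hFchain⟩ := Finset.mem_filter.1 hF𝒞
  have hFU' : (↑F : Set (Site 2 × Site 2)) ⊆ vEdges ℓ lam s x o η := fun e he ↦ by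
    have := Finset.mem_powerset.1 hFU he
    simpa [hU] using this
  have hbO : b ∈ O := hb.1.1.1
  have hb'O : b' ∈ O := hb'.1.1.1
  -- minimality: no nonempty sub-family can be removed
  have hmin : ∀ 𝒩 ⊆ F, 𝒩.Nonempty →
      ¬ Relation.ReflTransGen (fun a c ↦ (a, c) ∈ augSteps s x η ↑(F \ 𝒩)) b b' := by
    intro 𝒩 h𝒩 hne hch
    have hmem : F \ 𝒩 ∈ 𝒞 :=
      Finset.mem_filter.2 ⟨Finset.mem_powerset.2 (Finset.sdiff_subset.trans (Finset.mem_powerset.1 hFU)), hch⟩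
    have h1 := hFmin _ hmem
    have h2 : (F \ 𝒩).card < F.card := by
      obtain ⟨e, he⟩ := hne
      exact Finset.card_lt_card (Finset.sdiff_ssubset h𝒩 ⟨e, he⟩)
    omega
  refine ⟨F, hFU', ?_, ?_⟩
  · -- `F` is nonempty: with no virtual edge the chain would be a real path
    by_contra hemp
    rw [Finset.not_nonempty_iff_eq_empty] at hemp
    rcases real_or_endpoint_of_augChain (G := (↑F : Set (Site 2 × Site 2))) (fun e he ↦ mem_tBall_of_mem_vEdges (hFU' he))
      hbO hFchain with h | ⟨e, he, -⟩
    · exact hnR h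
    · simp [hemp] at he
  intro 𝒩 h𝒩 hne w Δ r R Γ hw hΔ hΓ hr hrR hRΓ hRs
  set G : Set (Site 2 × Site 2) := ↑(F \ 𝒩) with hG
  have hGF : G ⊆ ↑F := by intro e he; exact (Finset.mem_sdiff.1 (Finset.mem_coe.1 he)).1
  have hGO : ∀ e ∈ G, e.1 ∈ O ∧ e.2 ∈ O := fun e he ↦ mem_tBall_of_mem_vEdges (hFU' (hGF he))
  have hnG : ¬ Relation.ReflTransGen (fun a c ↦ (a, c) ∈ augSteps s x η G) b b' := hmin 𝒩 h𝒩 hne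
  have hsymm : ∀ (F' : Set (Site 2 × Site 2)) {a c : Site 2},
      Relation.ReflTransGen (fun a c ↦ (a, c) ∈ augSteps s x η F') a c →
      Relation.ReflTransGen (fun a c ↦ (a, c) ∈ augSteps s x η F') c a := by
    intro F' a c h
    induction h with
    | refl => exact Relation.ReflTransGen.refl
    | tail _ hyz ih =>
      exact (Relation.ReflTransGen.single (r := fun a c ↦ (a, c) ∈ augSteps s x η F') (augSteps_symm hyz)).trans ih
  -- the step of a full chain leaving a `G`-component is an `𝒩`-edge
  have hout : ∀ {c₀ c₁ : Site 2}, Relation.ReflTransGen (fun a c ↦ (a, c) ∈ augSteps s x η ↑F) c₀ c₁ →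
      ¬ Relation.ReflTransGen (fun a c ↦ (a, c) ∈ augSteps s x η G) c₀ c₁ →
      ∃ y e, e ∈ 𝒩 ∧ (y = e.1 ∨ y = e.2) ∧ Relation.ReflTransGen (fun a c ↦ (a, c) ∈ augSteps s x η G) c₀ y := by
    intro c₀ c₁ hch hn
    obtain ⟨y, z, hy, hz, hyz, -⟩ := reflTransGen_exists_step_out
      (P := {t | Relation.ReflTransGen (fun a c ↦ (a, c) ∈ augSteps s x η G) c₀ t}) hch Relation.ReflTransGen.refl hn
    simp only [mem_setOf_eq] at hy hz
    rcases hyz with hreal | hF | hF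
    · exact (hz (hy.tail (Or.inl hreal))).elim
    · by_cases hN : (y, z) ∈ 𝒩
      · exact ⟨y, (y, z), hN, Or.inl rfl, hy⟩
      · exact (hz (hy.tail (Or.inr (Or.inl (Finset.mem_coe.2 (Finset.mem_sdiff.2 ⟨Finset.mem_coe.1 hF, hN⟩)))))).elim
    · by_cases hN : (z, y) ∈ 𝒩
      · exact ⟨y, (z, y), hN, Or.inr rfl, hy⟩
      · exact (hz (hy.tail (Or.inr (Or.inr (Finset.mem_coe.2 (Finset.mem_sdiff.2 ⟨Finset.mem_coe.1 hF, hN⟩)))))).elim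
  obtain ⟨y, e₁, he₁, hy₁, hby⟩ := hout hFchain hnG
  obtain ⟨y', e₂, he₂, hy₂, hb'y'⟩ := hout (hsymm _ hFchain) fun h ↦ hnG (hsymm _ h)
  -- the two real classes are distinct
  have hnyy' : ¬ PathIn H O y y' := fun hp ↦
    hnG ((hby.trans (augChain_of_pathIn G hp)).trans (hsymm _ hb'y'))
  -- near: endpoints of `𝒩`-edges are inside `Λ_{r-1}(w)`
  have hnear : ∀ {y : Site 2} {e : Site 2 × Site 2}, e ∈ 𝒩 → (y = e.1 ∨ y = e.2) → triNorm (y - w) < r := by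
    intro y e he hy
    have hΔe := hΔ e he
    have hev : e ∈ vEdges ℓ lam s x o η := hFU' (h𝒩 he)
    rcases hy with rfl | rfl
    · have h1 := triNorm_sub_le_of_mem_vEdges hℓ (show (e.1, e.2) ∈ vEdges ℓ lam s x o η from hev)
      have h2 := triNorm_sub_le_triNorm_sub_add e.1 e.2 w
      omega
    · omega
  -- far: each class reaches distance `≥ R` from `w`
  have hfar : ∀ {c₀ y : Site 2}, IsCrossing triGraph H K O c₀ →
      Relation.ReflTransGen (fun a c ↦ (a, c) ∈ augSteps s x η G) c₀ y →
      ∃ q, PathIn H O y q ∧ (R : ℤ) ≤ triNorm (q - w) := by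
    intro c₀ y hc₀ hch
    rcases real_or_endpoint_of_augChain hGO hc₀.1.1.1 hch with hp | ⟨e, he, hp | hp⟩
    · obtain ⟨-, q, hqo, hpq⟩ := hc₀
      refine ⟨q, (PathIn.symm hp).trans (hpq.mono Set.sdiff_subset), ?_⟩
      have h1 := le_triNorm_of_mem_outerLayer hqo
      have h2 := triNorm_le_of_mem_innerLayer hw
      have h3 := triNorm_sub_le_triNorm_sub_add q w x
      push_cast at h1 hRs ⊢; omega
    · have heF : e ∈ F ∧ e ∉ 𝒩 := by simpa [hG] using he
      have hΓe := hΓ e heF.1 heF.2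
      have hev : e ∈ vEdges ℓ lam s x o η := hFU' heF.1
      refine ⟨e.1, PathIn.symm hp, ?_⟩
      have h1 := triNorm_sub_le_of_mem_vEdges hℓ (show (e.1, e.2) ∈ vEdges ℓ lam s x o η from hev)
      have h2 := triNorm_sub_le_triNorm_sub_add e.2 e.1 w
      have h3 : triNorm (e.2 - e.1) = triNorm (e.1 - e.2) := by rw [← triNorm_neg, neg_sub]
      omega
    · have heF : e ∈ F ∧ e ∉ 𝒩 := by simpa [hG] using he
      have hΓe := hΓ e heF.1 heF.2
      exact ⟨e.2, PathIn.symm hp, by omega⟩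
  obtain ⟨q, hyq, hqR⟩ := hfar hb hby
  obtain ⟨q', hy'q', hq'R⟩ := hfar hb' hb'y'
  obtain ⟨p₁, q₁, hp₁, hq₁, hcross₁, hyp₁⟩ := exists_crossing_of_pathIn hrR (hnear he₁ hy₁) hqR hyq
  obtain ⟨p₂, q₂, hp₂, hq₂, hcross₂, hy'p₂⟩ := exists_crossing_of_pathIn hrR (hnear he₂ hy₂) hq'R hy'q'
  refine ⟨p₁, q₁, p₂, q₂, hp₁, hq₁, hp₂, hq₂, hcross₁.mono inter_subset_right, hcross₂.mono inter_subset_right,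
    fun h12 ↦ hnyy' ?_⟩
  exact hyp₁.trans ((h12.mono (tAnn_subset_tBall hw (by omega))).trans (PathIn.symm hy'p₂))

/-- **Covering lemma for `𝔄`, closed form** (anchor of this module; all parameters explicit): see `covering_A`. -/
theorem covering_A_nodes : ∀ (ℓ lam s : ℕ) (x o : Site 2) (η : SiteConfig (Site 2)), 1 ≤ ℓ → 1 ≤ lam → lam + 1 ≤ s → η ∈ THookStar ℓ lam s x o → η ∉ THook x x s s → ∃ F : Finset (Site 2 × Site 2), (↑F : Set (Site 2 × Site 2)) ⊆ vEdges ℓ lam s x o η ∧ F.Nonempty ∧ ∀ 𝒩 ⊆ F, 𝒩.Nonempty → ∀ (w : Site 2) (Δ r R Γ : ℕ), w ∈ innerLayer triGraph (tBall x s) (tBall x (2 * s)) → (∀ e ∈ 𝒩, triNorm (e.2 - w) ≤ Δ) → (∀ e ∈ F, e ∉ 𝒩 → (Γ : ℤ) ≤ triNorm (e.2 - w)) → Δ + 2 * ℓ + 2 ≤ r → r ≤ R → R + 2 * ℓ + 2 ≤ Γ → R + 2 ≤ s → ∃ p₁ q₁ p₂ q₂ : Site 2, triNorm (p₁ - w)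 = r ∧ triNorm (q₁ - w) = R ∧ triNorm (p₂ - w) = r ∧ triNorm (q₂ - w) = R ∧ PathIn (tColourGraph η true) (tAnn w r R) p₁ q₁ ∧ PathIn (tColourGraph η true) (tAnn w r R) p₂ q₂ ∧ ¬ PathIn (tColourGraph η true) (tAnn w r R) p₁ p₂ :=
  fun _ _ _ _ _ _ hℓ hlam hls hS hnH ↦ covering_A hℓ hlam hls hS hnH

end Covering

end Summit.CriticalPhenomena.CardyFormulaZ2.Cruxes.NestingRigidity.PinchResampling

end
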